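import Summits.NavierStokesRegularity.NavierStokesRegularity.Theorems.TaoForcedUniqueness.Negative.SerrinEnstrophyProfile

/-!
# KJ-6 (2/9): Serrin-class bookkeeping `u ∈ L⁴_t L⁶_x`, integrability of `λ⁴ ~ |t − T/2|^{-1/2}`, and the abstract co-moving JUNK FAMILY

Cell `ns-blowup`, seat `ns-blowup-refuter` (g10 blueprint, g11 kernel), KILLSHEET §XXIV rows KJ-6/KJ-7,
part 2/9 of the kernel certificate `¬ Literature.Analysis.FluidPDE.Sohr2001_serrinClass_enstrophyBound(_global)`
(final file `SohrSerrinEnstrophyCountableJunk.lean` in this directory, which carries the full account and the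
classification). LABEL: refuter construction (explicit data + proved lemmas; no named facts, no `sorry`).
WHAT THIS IS NOT: not Navier–Stokes evidence and not a statement about Sohr's printed theorem — a hygiene
refutation of two facts AS TYPED (slice-wise force class `MemLqLp 2 2`, one outer Bochner integral in the
weak form); nothing here mentions the summit.

Content: `‖U_c‖₆ = c ‖U‖₆` (`eLpNorm_dilate_six`), `‖u(t)‖₆ ≤ |t| λ(t) ‖U‖₆`, `MemLp (uW T t) 6`;
`integrableOn_abs_sub_rpow` (`|t − a|^s` is integrable near `a` for `s > −1`), `λ ∈ L⁴(lo, hi)`, `λ² ∈ L²(lo, hi)`,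
measurability of `λ`, `λ²`; `‖U_c‖₂ = ‖U‖₂` (`eLpNorm_dilate_two`); `0 ≤ c₁`, `0 ≤ κ ≤ 1 + ν T λ² c₁`; the structure
`JunkFamily Pr` (for each scale `c` a countable family `Φ c m`, `Φ c 0 = 0`, `‖Φ c m‖₂ ≤ 1`, orthogonal to `U_c`,
total modulo `U_c` against `C_c` fields, jointly measurable in `(c, x)`), constructed in part 3.
-/

noncomputable section

namespace Summit.NavierStokesRegularity.ForcedUniquenessHygiene.KJ6

open MeasureTheory Set Function Filter Topology Metric
open scoped ENNReal NNReal RealInnerProductSpace ContDiff Laplacian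
open Literature.Analysis.FluidPDE Literature.Analysis.FunctionSpaces

/-- Euclidean `ℝ³` (file-local notation, as in the `Literature.Analysis.FluidPDE` files). -/
local notation "ℝ³" => EuclideanSpace ℝ (Fin 3)

variable (Pr : Profile)

/-! ### Serrin-class bookkeeping for the witness (`L⁴_t L⁶_x`) -/

/-- `U ∈ L²`. -/
theorem memLp_profile_two : MemLp Pr.U 2 volume := Pr.memLp 2 le_rfl (by simp)

/-- `U ∈ L⁶`. -/
theorem memLp_profile_six : MemLp Pr.U 6 volume := Pr.memLp 6 (by norm_num) (by simp)

/-- `‖U_c‖₆ = c ‖U‖₆` (`c^{3/2 - 3/6} = c`). -/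
theorem eLpNorm_dilate_six {c : ℝ} (hc : 0 < c) (U : ℝ³ → ℝ³) :
    eLpNorm (dilate c U) 6 volume = ENNReal.ofReal c * eLpNorm U 6 volume := by
  rw [dilate, eLpNorm_const_smul, eLpNorm_nsRescaleData_of_ne_zero 6 U hc.ne', ← mul_assoc,
    ← mul_assoc]
  congr 1
  have hfin : Module.finrank ℝ ℝ³ = 3 := by simp
  have h3pos : 0 < (c ^ 3)⁻¹ := inv_pos.2 (pow_pos hc 3)
  rw [hfin, Real.enorm_eq_ofReal (Real.sqrt_nonneg c), Real.enorm_eq_ofReal hc.le,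
    abs_of_pos h3pos, ENNReal.ofReal_rpow_of_nonneg h3pos.le ENNReal.toReal_nonneg,
    ← ENNReal.ofReal_mul (Real.sqrt_nonneg c),
    ← ENNReal.ofReal_mul (mul_nonneg (Real.sqrt_nonneg c) hc.le)]
  congr 1
  have h16 : ((1 : ℝ≥0∞) / 6).toReal = 1 / 6 := by simp
  rw [h16]
  have h3 : (c ^ 3)⁻¹ ^ (1 / 6 : ℝ) = (Real.sqrt c)⁻¹ := by
    rw [Real.inv_rpow (pow_nonneg hc.le 3), ← Real.rpow_natCast c 3, ← Real.rpow_mul hc.le,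
      Real.sqrt_eq_rpow]
    norm_num
  rw [h3]
  have hs : Real.sqrt c ≠ 0 := (Real.sqrt_pos.2 hc).ne'
  field_simp

/-- `‖u(t)‖₆ ≤ |t| λ(t) ‖U‖₆` (equality off `t = T/2`). -/
theorem eLpNorm_uW_le (T t : ℝ) :
    eLpNorm (uW Pr T t) 6 volume ≤ ENNReal.ofReal (|t| * lam T t) * eLpNorm Pr.U 6 volume := by
  unfold uW
  split_ifs with h
  · simp
  · rw [eLpNorm_const_smul, eLpNorm_dilate_six (lam_pos T t), ← mul_assoc, Real.enorm_eq_ofReal_abs,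
      ← ENNReal.ofReal_mul (abs_nonneg t)]

/-- Every slice of the witness is in `L⁶`. -/
theorem memLp_uW_slice (T t : ℝ) : MemLp (uW Pr T t) 6 volume := by
  unfold uW
  split_ifs with h
  · exact MemLp.zero
  · unfold dilate
    exact ((memLp_nsRescaleData (memLp_profile_six Pr) (lam_pos T t).ne').const_smul _).const_smul _

/-- `t ↦ |t − a|^s` is integrable on bounded intervals for `s > −1`. -/
theorem integrableOn_abs_sub_rpow (a lo hi : ℝ) {s : ℝ} (hs : -1 < s) :
    IntegrableOn (fun t : ℝ => |t - a| ^ s) (Ioo lo hi) := by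
  set c := |lo - a| + |hi - a| + 1 with hc_def
  have hc : 0 < c := by positivity
  have hsub : Ioo lo hi ⊆ Ioo (a - c) a ∪ ({a} ∪ Ioo a (a + c)) := by
    intro t ht
    rcases lt_trichotomy t a with h | h | h
    · left
      exact ⟨by linarith [ht.1, neg_abs_le (lo - a), abs_nonneg (hi - a)], h⟩
    · right; left; exact h
    · right; right
      exact ⟨h, by linarith [ht.2, le_abs_self (hi - a), abs_nonneg (lo - a)]⟩
  have h0 : IntegrableOn (fun x : ℝ => x ^ s) (Ioo 0 c) :=
    (intervalIntegral.integrableOn_Ioo_rpow_iff hc).2 hs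
  have hR : IntegrableOn (fun t : ℝ => |t - a| ^ s) (Ioo a (a + c)) := by
    have h1 : IntegrableOn ((fun x : ℝ => x ^ s) ∘ fun t => t - a) ((fun t => t - a) ⁻¹' Ioo 0 c) :=
      ((measurePreserving_sub_right volume a).integrableOn_comp_preimage
        (MeasurableEquiv.subRight a).measurableEmbedding).2 h0
    refine (h1.mono_set ?_).congr_fun ?_ measurableSet_Ioo
    · intro t ht
      simp only [mem_preimage, mem_Ioo] at ht ⊢
      constructor <;> linarith [ht.1, ht.2]
    · intro t ht
      simp only [comp_apply]
      rw [abs_of_pos (sub_pos.2 ht.1)]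
  have hL : IntegrableOn (fun t : ℝ => |t - a| ^ s) (Ioo (a - c) a) := by
    have h1 : IntegrableOn ((fun x : ℝ => x ^ s) ∘ fun t => a - t) ((fun t => a - t) ⁻¹' Ioo 0 c) :=
      ((Measure.measurePreserving_sub_left volume a).integrableOn_comp_preimage
        (measurableEmbedding_subLeft a)).2 h0
    refine (h1.mono_set ?_).congr_fun ?_ measurableSet_Ioo
    · intro t ht
      simp only [mem_preimage, mem_Ioo] at ht ⊢
      constructor <;> linarith [ht.1, ht.2]
    · intro t ht
      simp only [comp_apply]
      rw [abs_of_neg (sub_neg.2 ht.2), neg_sub]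
  have hpt : IntegrableOn (fun t : ℝ => |t - a| ^ s) {a} := by
    rw [integrableOn_singleton_iff]
    right
    simp
  exact (hL.union (hpt.union hR)).mono_set hsub

/-- `λ⁴ = (1 + |t − T/2|^{-1/4})²` is integrable on bounded intervals. -/
theorem integrableOn_lamSq_sq (T lo hi : ℝ) : IntegrableOn (fun t => lamSq T t ^ 2) (Ioo lo hi) := by
  have hr1 := integrableOn_abs_sub_rpow (T / 2) lo hi (s := -(1 / 4 : ℝ)) (by norm_num)
  have hr2 := integrableOn_abs_sub_rpow (T / 2) lo hi (s := -(1 / 2 : ℝ)) (by norm_num)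
  have h1 : IntegrableOn (fun _ : ℝ => (1 : ℝ)) (Ioo lo hi) :=
    integrableOn_const (measure_Ioo_lt_top (μ := volume)).ne
  have hsum : IntegrableOn
      (fun t => 1 + 2 * |t - T / 2| ^ (-(1 / 4 : ℝ)) + |t - T / 2| ^ (-(1 / 2 : ℝ))) (Ioo lo hi) :=
    (h1.add (hr1.const_mul 2)).add hr2
  refine hsum.congr_fun (fun t _ => ?_) measurableSet_Ioo
  have h2 : |t - T / 2| ^ (-(1 / 2 : ℝ)) = (|t - T / 2| ^ (-(1 / 4 : ℝ))) ^ 2 := by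
    rw [← Real.rpow_natCast, ← Real.rpow_mul (abs_nonneg _)]
    norm_num
  simp only [lamSq, h2]
  ring

/-- `λ` is measurable. -/
theorem measurable_lam (T : ℝ) : Measurable (lam T) := by
  unfold lam lamSq
  exact (measurable_const.add
    ((continuous_abs.measurable.comp (measurable_id.sub_const _)).pow_const _)).sqrt

/-- `λ ∈ L⁴(lo, hi)`. -/
theorem memLp_lam (T lo hi : ℝ) : MemLp (lam T) 4 (volume.restrict (Ioo lo hi)) := by
  rw [← integrable_norm_rpow_iff (measurable_lam T).aestronglyMeasurable (by norm_num) (by norm_num)]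
  have h := integrableOn_lamSq_sq T lo hi
  refine h.congr_fun (fun t _ => ?_) measurableSet_Ioo
  have h4 : (4 : ℝ≥0∞).toReal = ((4 : ℕ) : ℝ) := by norm_num
  show lamSq T t ^ 2 = ‖lam T t‖ ^ (4 : ℝ≥0∞).toReal
  rw [Real.norm_of_nonneg (lam_pos T t).le, h4, Real.rpow_natCast, ← lam_sq]
  ring

/-- `‖U_c‖₂ = ‖U‖₂`: the dilate is `L²`-unitary. -/
theorem eLpNorm_dilate_two {c : ℝ} (hc : 0 < c) (U : ℝ³ → ℝ³) :
    eLpNorm (dilate c U) 2 volume = eLpNorm U 2 volume := by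
  rw [dilate, eLpNorm_const_smul, eLpNorm_nsRescaleData_of_ne_zero 2 U hc.ne', ← mul_assoc,
    ← mul_assoc]
  conv_rhs => rw [← one_mul (eLpNorm U 2 volume)]
  congr 1
  have hfin : Module.finrank ℝ ℝ³ = 3 := by simp
  have h3pos : 0 < (c ^ 3)⁻¹ := inv_pos.2 (pow_pos hc 3)
  have h12 : ((1 : ℝ≥0∞) / 2).toReal = 1 / 2 := by simp
  rw [hfin, Real.enorm_eq_ofReal (Real.sqrt_nonneg c), Real.enorm_eq_ofReal hc.le,
    abs_of_pos h3pos, h12, ENNReal.ofReal_rpow_of_nonneg h3pos.le (by norm_num),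
    ← ENNReal.ofReal_mul (Real.sqrt_nonneg c),
    ← ENNReal.ofReal_mul (mul_nonneg (Real.sqrt_nonneg c) hc.le), ENNReal.ofReal_eq_one]
  have h3 : (c ^ 3)⁻¹ ^ (1 / 2 : ℝ) = (c * Real.sqrt c)⁻¹ := by
    rw [Real.inv_rpow (pow_nonneg hc.le 3), ← Real.sqrt_eq_rpow, show c ^ 3 = c * c * c by ring,
      Real.sqrt_mul (mul_self_nonneg c) c, Real.sqrt_mul_self hc.le]
  rw [h3]
  have hs : Real.sqrt c ≠ 0 := (Real.sqrt_pos.2 hc).ne'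
  have hc0 : c ≠ 0 := hc.ne'
  field_simp

/-- `0 ≤ c₁`. -/
theorem c₁_nonneg : 0 ≤ c₁ Pr :=
  div_nonneg ENNReal.toReal_nonneg (integral_nonneg fun _ => sq_nonneg _)

/-- `0 ≤ κ(t) ≤ 1 + ν T c₁ λ(t)²` on `(0, T]`. -/
theorem kappa_nonneg {ν T t : ℝ} (hν : 0 ≤ ν) (ht : 0 ≤ t) : 0 ≤ kappa Pr ν T t := by
  unfold kappa
  have := mul_nonneg (mul_nonneg (mul_nonneg hν ht) (lamSq_pos T t).le) (c₁_nonneg Pr)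
  linarith

/-- `κ(t) ≤ 1 + ν T c₁ λ(t)²` for `t ≤ T`, `ν ≥ 0`. -/
theorem kappa_le {ν T t : ℝ} (hν : 0 ≤ ν) (htT : t ≤ T) :
    kappa Pr ν T t ≤ 1 + ν * T * c₁ Pr * lamSq T t := by
  unfold kappa
  have h1 : ν * t * lamSq T t * c₁ Pr ≤ ν * T * lamSq T t * c₁ Pr := by
    have := (lamSq_pos T t).le
    have := c₁_nonneg Pr
    gcongr
  linarith

/-- `λ²` is measurable. -/
theorem measurable_lamSq (T : ℝ) : Measurable (lamSq T) := by
  unfold lamSq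
  exact measurable_const.add
    ((continuous_abs.measurable.comp (measurable_id.sub_const _)).pow_const _)

/-- `λ² ∈ L²(lo, hi)`. -/
theorem memLp_lamSq (T lo hi : ℝ) : MemLp (lamSq T) 2 (volume.restrict (Ioo lo hi)) := by
  rw [← integrable_norm_rpow_iff (measurable_lamSq T).aestronglyMeasurable (by norm_num) (by norm_num)]
  have h := integrableOn_lamSq_sq T lo hi
  refine h.congr_fun (fun t _ => ?_) measurableSet_Ioo
  show lamSq T t ^ 2 = ‖lamSq T t‖ ^ (2 : ℝ≥0∞).toReal
  rw [Real.norm_of_nonneg (lamSq_pos T t).le, ENNReal.toReal_ofNat, Real.rpow_two]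

/-- Abstract junk family attached to the profile: for each scale a countable family, orthogonal to
`U_λ`, total modulo `U_λ` against compactly supported continuous fields, uniformly `L²`-bounded,
jointly measurable in (scale, space). NO smoothness is demanded (the typed force class `MemLqLp 2 2`
only sees `L²` slices). CONSTRUCTION (`exists_junkFamily`, part 3 `SerrinEnstrophyJunkFamily.lean`, on
refuter4's K54 part 2 `CountableJunkDirections.lean`: rational bumps `bumpVec i = ρ_{q,n} • e_j`,
`i = idxEnum m : ℚ³ × ℕ × Fin 3`, and the neighbourhood-basis totality lemma
`eq_zero_of_forall_integral_bump_mul`):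
`Φ c 0 := 0`, `Φ c (m+1) := s(c,i) • (bumpVec i − β(c,i) • U_c)`, `β(c,i) := (∫⟪bumpVec i, U_c⟫) / ∫⟪U_c,U_c⟫`,
`s(c,i) := (1 + ‖bumpVec i − β(c,i) U_c‖₂)⁻¹` (so `norm_le` with no Cauchy–Schwarz); `orth` is the algebra
of refuter4's `integral_inner_projVec_swirl` with `∫⟪U_c,U_c⟫ > 0` (`U_c` continuous and `≠ 0`
somewhere: `Pr.far ∅`); `total`: `⟪Φ c (m+1), ψ⟫ = 0 ∀ m` gives `⟪bumpVec i, ψ − α U_c⟫ = 0 ∀ i`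
(`α = ⟪U_c, ψ⟫/‖U_c‖₂²`), the components of the continuous field `ψ − α U_c` vanish by
`eq_zero_of_forall_integral_bump_mul`, so `ψ = α • U_c`; `measurable`: `(c,x) ↦ U_c x` is continuous,
`c ↦ β(c,i)`, `c ↦ ∫⟪U_c,U_c⟫` are measurable by `StronglyMeasurable.integral_prod_right'`, and
`c ↦ ‖projC c i‖₂` by `Measurable.lintegral_prod_right'`. -/
structure JunkFamily where
  Φ : ℝ → ℕ → ℝ³ → ℝ³
  zero : ∀ c, Φ c 0 = 0
  memLp : ∀ c m, MemLp (Φ c m) 2 volume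
  norm_le : ∀ c m, eLpNorm (Φ c m) 2 volume ≤ 1
  orth : ∀ c m, 0 < c → ∫ x, ⟪Φ c m x, dilate c Pr.U x⟫ = 0
  total : ∀ c, 0 < c → ∀ ψ : ℝ³ → ℝ³, Continuous ψ → HasCompactSupport ψ →
    (∀ m, 1 ≤ m → ∫ x, ⟪Φ c m x, ψ x⟫ = 0) → ∃ a : ℝ, ψ = a • dilate c Pr.U
  measurable : ∀ m, Measurable (uncurry fun c x => Φ c m x)

end Summit.NavierStokesRegularity.ForcedUniquenessHygiene.KJ6
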